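import Summits.QuantumFields.YangMills.Theorems.IR.LevelwiseDominationCounting
import HarnessLib

/-!
# Crux `IRcof` (stmt-QuantumFields-26930) — supplier line «lipschitz-vacuum-transport», part 6: LW-DOM IN DENSITY-OF-STATES CURRENCY

Helper module for `Summit.QuantumFields.YangMills.Theses.BalabanLadder.IRcof` (`--supports stmt-QuantumFields-26930`; closes nothing), crux LEAD
ymfull-r2c-lead-1 g1.  By `levelMatched_iff_counting` (part 4, Hall's marriage theorem) the line statement `LevelwiseDominatedCofinal` is
EQUIVALENT to the same quantifier block with «every ratio datum is level-matched into the free tower of mass `μ·a(β)`» replaced by the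
density-of-states domination «for every energy `E`, every finite family of transfer-matrix ratio levels `≥ e^{−E}` has at most
`#freeCount d (μ·a(β)) c L E` members» (`levelwiseDominatedCofinal_iff_dos`).  This is the currency in which the critic typed the DOS hypothesis
of the sibling supplier line «no-halving-octave» (finite families over the built idiom `IsRatioDatum`), so the two suppliers of the slot stub
`stub_pinnedExitsCofinal` are now comparable term by term: LW-DOM = (gap `μ` in floor units, uniform in the pinned volume) ∧ (level count
dominated by a `d`-species free count, a bound EXPONENTIAL in `L³`); no-halving's conversion asks for a count POLYNOMIAL in `L`.

HONEST FRAMING: a reformulation of an OPEN, width-0 line statement; nothing here proves `LevelwiseDominatedCofinal`, `PinnedExitsCofinalAt (1/24)`,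
`IRnscCof`, `IRcof`, `IR`, any leg, or the Yang–Mills mass gap (Clay) — NOT proved; NOT continuum ∕ OS.
-/

set_option autoImplicit false

noncomputable section

open Filter Topology MeasureTheory
open scoped BigOperators
open Literature.MathematicalPhysics.QuantumFieldTheory Literature.MathematicalPhysics.QuantumLattice
open Summit.QuantumFields.YangMills.Cruxes.OSLegsFromFemtoAndGap.DlrCollarTransfer (LowerBounds)
open Summit.QuantumFields.YangMills.Cruxes.IR.RankPurity (IsRatioDatum)

namespace Summit.QuantumFields.YangMills.Cruxes.IR.LevelwiseDomination

/-- **LW-DOM ⟺ cofinal pinned DOS domination.**  `LevelwiseDominatedCofinal` restated with the level-matching clause replaced by the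
counting clause of `levelMatched_iff_counting` (levels of a ratio datum are in `[0,1]`, and the mass `μ·a(β)` is positive, so the pointwise
equivalence applies under the binders). -/
theorem levelwiseDominatedCofinal_iff_dos :
    LevelwiseDominatedCofinal ↔
    ∀ (G : Type) [Group G] [TopologicalSpace G] [IsTopologicalGroup G] [CompactSpace G],
      IsCompactSimpleLieGroup G → SimplyConnectedSpace G →
      letI : MeasurableSpace G := borel G
      haveI : BorelSpace G := ⟨rfl⟩
      ∀ (r : LatticeRep G) (a : ℝ → ℝ), (∀ β, 0 < a β) → Tendsto a atTop (𝓝 0) → LowerBounds G r a →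
        ∃ (d : ℕ) (c μ T₀ : ℝ), 0 < c ∧ 0 < μ ∧ ∀ T : ℝ, T₀ ≤ T → ∀ β₁ : ℝ, ∃ β : ℝ, β₁ ≤ β ∧ 0 ≤ β ∧
          ∃ (L : ℕ) (_ : NeZero L), 8 ≤ L ∧ T ≤ a β * (L : ℝ) ∧ a β * (L : ℝ) ≤ 2 * T ∧
            ∀ (ι : Type) [DecidableEq ι] (rr : ι → ℝ) (i₀ : ι), IsRatioDatum r.ρ β L ι rr i₀ →
              ∀ (E : ℝ) (F : Finset ι), (∀ i ∈ F, Real.exp (-E) ≤ rr i) →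
                F.card ≤ (freeCount d (μ * a β) c L E).card := by
  constructor
  · intro h G _ _ _ _ hG hsc
    letI : MeasurableSpace G := borel G
    haveI : BorelSpace G := ⟨rfl⟩
    intro r a ha ha0 hlb
    obtain ⟨d, c, μ, T₀, hc, hμ, hdom⟩ := h G hG hsc r a ha ha0 hlb
    refine ⟨d, c, μ, T₀, hc, hμ, fun T hT β₁ => ?_⟩
    obtain ⟨β, hβ₁, hβ0, L, instL, hL8, hTle, hleT, hlw⟩ := hdom T hT β₁
    refine ⟨β, hβ₁, hβ0, L, instL, hL8, hTle, hleT, fun ι _ rr i₀ hrd E F hF => ?_⟩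
    exact card_le_freeCount_of_levelMatched (mul_pos hμ (ha β)) (hlw ι rr i₀ hrd) E F hF
  · intro h G _ _ _ _ hG hsc
    letI : MeasurableSpace G := borel G
    haveI : BorelSpace G := ⟨rfl⟩
    intro r a ha ha0 hlb
    obtain ⟨d, c, μ, T₀, hc, hμ, hdom⟩ := h G hG hsc r a ha ha0 hlb
    refine ⟨d, c, μ, T₀, hc, hμ, fun T hT β₁ => ?_⟩
    obtain ⟨β, hβ₁, hβ0, L, instL, hL8, hTle, hleT, hcount⟩ := hdom T hT β₁
    refine ⟨β, hβ₁, hβ0, L, instL, hL8, hTle, hleT, fun ι _ rr i₀ hrd => ?_⟩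
    exact levelMatched_of_counting (fun i => (hrd.1 i).1) (hcount ι rr i₀ hrd)

end Summit.QuantumFields.YangMills.Cruxes.IR.LevelwiseDomination

end
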